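import Summits.AtomisticToContinuum.BoseEinsteinCondensation.Theorems.BECThomsonPrincipleGDTransferSeededPlainPairsBdd
import Summits.AtomisticToContinuum.BoseEinsteinCondensation.Theorems.BECThomsonPrincipleGDTransferSeededPlainInteraction

/-!
# Route `BECThomsonPrinciple`, crux `GDTransfer` (stmt-AtomisticToContinuum-9482), line `seeded-continuity`:
# stub `stub_bandEmptinessBdd`, part 3 — the interaction double commutator of the plain pair, BOUNDED MEASURABLE profile

Support file (part 3) of the registered stub `stub_bandEmptinessBdd` of skeleton v6, continuing parts 1–2
(`…SeededPlainFormsBdd`, `…SeededPlainPairsBdd`).  Twins (suffix `_bdd`) of `…SeededPlainInteractionBracket`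
(`abs_re_pairBracket_le`) and `…SeededPlainInteraction` (`bracket_split`, `sum_pairEnergy_le`, `stub_plainInteraction`)
with `IsFiniteContinuous v` replaced by boundedness: at a fixed side by `∀ x, v^per_L(x) ≤ C`, globally by
`∀ r ≥ 0, v r ≤ B` (the unfolded `IsBoundedProfile v` of `…SeededTransportDefs`; a bounded finite-range profile is
integrable on `ℝ³`, `lintegral_ne_top_of_bdd`, and has bounded periodisation at every side,
`exists_periodized_bound_of_bdd` ← `exists_bound_periodizedPotential_of_space`).  Outcome: the conclusion of
`PlainInteractionBound` for every admissible BOUNDED profile — `|𝒟^V(Ψ)| ≤ C(ρ + √(ρE(Ψ)/N))`, `ρ = N/L³`,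
`C = 8(‖v‖₁ + √‖v‖₁) + 1` (`plainInteractionBound_bdd`; registered helper statement `plainInteractionBdd_bound`).
All [folklore] (KennedyLiebShastry1988 §2; arXiv:1211.2778 §2; LSSY2005 App. A).
-/

noncomputable section

open MeasureTheory Filter
open scoped ENNReal NNReal ComplexConjugate

namespace Summit.AtomisticToContinuum.BoseEinsteinCondensation.Cruxes.GDTransfer.Seeded

namespace PlainInteraction

open Literature.MathematicalPhysics.QuantumManyBody.BoseGas
open Summit.AtomisticToContinuum.BoseEinsteinCondensation.Theorems.GaussianDominationCan.Negative
open Summit.AtomisticToContinuum.BoseEinsteinCondensation.Cruxes.GDTransfer.DysonDressedWitness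
open Lnss Sector

variable {N m : ℕ} {L : ℝ}

/-! ## Bounded finite-range profiles: integrability on `ℝ³`, bounded periodisation -/

/-- A bounded profile of finite range is integrable on `ℝ³` (bounded and compactly supported lift). [folklore] -/
theorem lintegral_ne_top_of_bdd {v : ℝ → ℝ≥0∞} (hv : IsRepulsiveFiniteRange v) {B : ℝ}
    (hB : ∀ r, 0 ≤ r → v r ≤ ENNReal.ofReal B) : (∫⁻ x : Space, v ‖x‖) ≠ ⊤ := by
  -- adapted from `lintegral_ne_top_of_isFiniteContinuous`
  obtain ⟨-, R₀, hR₀⟩ := hv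
  set R : ℝ := max R₀ 0 with hR
  have hsupp : ∀ x : Space, x ∉ Metric.closedBall (0 : Space) R → v ‖x‖ = 0 := fun x hx => by
    rw [Metric.mem_closedBall, dist_zero_right, not_le] at hx
    exact hR₀ _ ((le_max_left _ _).trans_lt hx)
  have hle : ∀ x : Space, v ‖x‖ ≤ (Metric.closedBall (0 : Space) R).indicator (fun _ => ENNReal.ofReal B) x := by
    intro x
    by_cases hx : x ∈ Metric.closedBall (0 : Space) R
    · rw [Set.indicator_of_mem hx]; exact hB _ (norm_nonneg _)
    · rw [hsupp x hx]; exact bot_le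
  refine ne_top_of_le_ne_top ?_ (lintegral_mono hle)
  rw [lintegral_indicator Metric.isClosed_closedBall.measurableSet, setLIntegral_const]
  exact ENNReal.mul_ne_top ENNReal.ofReal_ne_top (measure_closedBall_lt_top (x := (0 : Space))).ne

/-- A bounded profile of finite range has a bounded periodisation at every side `L > 0` (finitely many lattice
images meet the support). [folklore] -/
theorem exists_periodized_bound_of_bdd {v : ℝ → ℝ≥0∞} (hv : IsRepulsiveFiniteRange v) {B : ℝ}
    (hB : ∀ r, 0 ≤ r → v r ≤ ENNReal.ofReal B) (hL : 0 < L) : ∃ C : ℝ≥0, ∀ x, periodizedPotential v L x ≤ C := by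
  obtain ⟨-, R₀, hR₀⟩ := hv
  exact Theorems.exists_bound_periodizedPotential_of_space hL (M := Real.toNNReal B)
    (fun x => hB _ (norm_nonneg _)) hR₀

/-! ## The local bound of one pair (bounded periodisation) -/

/-- **The local bound of one pair**, bounded periodisation `v^per_L ≤ C`: for `p ≠ q`, continuous `ψ` with
`∫|ψ|² ≤ 1`, `|Re 𝒟^{pq}| ≤ 8(L⁻³‖v‖₁) + 8√(L⁻³‖v‖₁)√(∫v^per_{pq}|ψ|²)` — rows `i ∉ {p,q}` purely imaginary, entries
`i ∈ {p,q} ∌ j` vanishing, the four `(i,j) ∈ {p,q}²` bounded (part 2). [folklore] -/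
theorem abs_re_pairBracket_le_bdd {v : ℝ → ℝ≥0∞} {C : ℝ≥0} (hL : 0 < L) (hv : IsRepulsiveFiniteRange v)
    (hC : ∀ x, periodizedPotential v L x ≤ C) (n : Fin 3 → ℤ) {p q : Fin (m + 1)} (hpq : p ≠ q)
    {ψ : Config (m + 1) → ℂ} (hψ : Continuous ψ) (hψ1 : ∫ X in cellN (m + 1) L, ‖ψ X‖ ^ 2 ≤ 1) :
    |((∫ X in cellN (m + 1) L, (((periodizedPotential v L (X p - X q)).toReal : ℝ) : ℂ) *
        (conj (∑ i, cellWave L n (X i) * cellAvg (m + 1) L i ψ X) *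
          ∑ i, cellWave L n (X i) * cellAvg (m + 1) L i ψ X)) +
      (∫ X in cellN (m + 1) L, (((periodizedPotential v L (X p - X q)).toReal : ℝ) : ℂ) *
        (conj (∑ i, fourierAvg m L n i ψ X) * ∑ i, fourierAvg m L n i ψ X)) -
      (∫ X in cellN (m + 1) L, (((periodizedPotential v L (X p - X q)).toReal : ℝ) : ℂ) *
        (conj (∑ i, cellWave L n (X i) *
          cellAvg (m + 1) L i (fun Y => ∑ j, fourierAvg m L n j ψ Y) X) * ψ X)) -
      ∫ X in cellN (m + 1) L, (((periodizedPotential v L (X p - X q)).toReal : ℝ) : ℂ) *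
        (conj (∑ i, fourierAvg m L n i (fun Y => ∑ j, cellWave L n (Y j) * cellAvg (m + 1) L j ψ Y) X) *
          ψ X)).re| ≤
      8 * ((ENNReal.ofReal (L ^ 3))⁻¹ * ∫⁻ x : Space, v ‖x‖).toReal +
        8 * (Real.sqrt ((ENNReal.ofReal (L ^ 3))⁻¹ * ∫⁻ x : Space, v ‖x‖).toReal *
          Real.sqrt (∫ X in cellN (m + 1) L, (periodizedPotential v L (X p - X q)).toReal * ‖ψ X‖ ^ 2)) := by
  -- adapted from `abs_re_pairBracket_le` (finite continuous profile)
  classical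
  rw [bracket_expand_bdd (measurable_pairWeight hv L p q) (norm_pairWeight_le hC p q) n hψ]
  have hA : (({p, q} : Finset (Fin (m + 1))).card : ℝ) = 2 := by
    rw [Finset.card_pair hpq, Nat.cast_ofNat]
  have hmem : ∀ k : Fin (m + 1), k ∈ ({p, q} : Finset (Fin (m + 1))) ↔ k = p ∨ k = q := fun k => by
    rw [Finset.mem_insert, Finset.mem_singleton]
  have key := abs_re_sum_sum_le ({p, q} : Finset (Fin (m + 1)))
    (fun i j => ∫ X in cellN (m + 1) L, (((periodizedPotential v L (X p - X q)).toReal : ℝ) : ℂ) *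
      (conj (cellWave L n (X i) * cellAvg (m + 1) L i ψ X) * (cellWave L n (X j) * cellAvg (m + 1) L j ψ X)))
    (fun i j => ∫ X in cellN (m + 1) L, (((periodizedPotential v L (X p - X q)).toReal : ℝ) : ℂ) *
      (conj (fourierAvg m L n i ψ X) * fourierAvg m L n j ψ X))
    (fun i j => ∫ X in cellN (m + 1) L, (((periodizedPotential v L (X p - X q)).toReal : ℝ) : ℂ) *
      (conj (cellWave L n (X i) * cellAvg (m + 1) L i (fourierAvg m L n j ψ) X) * ψ X))
    (fun i j => ∫ X in cellN (m + 1) L, (((periodizedPotential v L (X p - X q)).toReal : ℝ) : ℂ) *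
      (conj (fourierAvg m L n i (fun Y => cellWave L n (Y j) * cellAvg (m + 1) L j ψ Y) X) * ψ X))
    (σ := ((ENNReal.ofReal (L ^ 3))⁻¹ * ∫⁻ x : Space, v ‖x‖).toReal)
    (e := ∫ X in cellN (m + 1) L, (periodizedPotential v L (X p - X q)).toReal * ‖ψ X‖ ^ 2)
    (fun i hi j => by
      rw [hmem, not_or] at hi
      exact ⟨pair_t1_eq_conj_t4_bdd hv hC n (Ne.symm hi.1) (Ne.symm hi.2) j hψ,
        pair_t2_eq_conj_t3_bdd hv hC n (Ne.symm hi.1) (Ne.symm hi.2) j hψ⟩)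
    (fun i hi j hj => by
      rw [hmem] at hi
      rw [hmem, not_or] at hj
      have hij : i ≠ j := by
        rintro rfl
        rcases hi with rfl | rfl
        · exact hj.1 rfl
        · exact hj.2 rfl
      exact ⟨pair_t1_eq_t3_bdd hv hC n hij (Ne.symm hj.1) (Ne.symm hj.2) hψ,
        pair_t2_eq_t4_bdd hv hC n hij (Ne.symm hj.1) (Ne.symm hj.2) hψ⟩)
    (fun i hi j hj => pair_local_bounds_bdd hL hv hC hpq hψ hψ1 n ((hmem i).1 hi) ((hmem j).1 hj))
  rw [hA] at key
  refine key.trans_eq ?_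
  ring

/-! ## Assembly: splitting over pairs, pair energies, the constant (bounded profile) -/

section AssemblyBdd

variable {v : ℝ → ℝ≥0∞} {C : ℝ≥0}

/-- **Splitting over pairs** (bounded periodisation): with the full weight `V = Σ_{p<q} v^per(x_p − x_q)` the
double-commutator form is the sum over `p < q` of the pair forms. [folklore] -/
theorem bracket_split_bdd (hv : IsRepulsiveFiniteRange v) (hC : ∀ x, periodizedPotential v L x ≤ C) (n : Fin 3 → ℤ)
    {ψ : Config (m + 1) → ℂ} (hψ : Continuous ψ) :
    ((∫ X in cellN (m + 1) L, (((periodicInteraction v L X).toReal : ℝ) : ℂ) *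
          (conj (∑ i, cellWave L n (X i) * cellAvg (m + 1) L i ψ X) *
            ∑ i, cellWave L n (X i) * cellAvg (m + 1) L i ψ X)) +
        (∫ X in cellN (m + 1) L, (((periodicInteraction v L X).toReal : ℝ) : ℂ) *
          (conj (∑ i, fourierAvg m L n i ψ X) * ∑ i, fourierAvg m L n i ψ X)) -
        (∫ X in cellN (m + 1) L, (((periodicInteraction v L X).toReal : ℝ) : ℂ) *
          (conj (∑ i, cellWave L n (X i) *
            cellAvg (m + 1) L i (fun Y => ∑ j, fourierAvg m L n j ψ Y) X) * ψ X)) -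
        ∫ X in cellN (m + 1) L, (((periodicInteraction v L X).toReal : ℝ) : ℂ) *
          (conj (∑ i, fourierAvg m L n i (fun Y => ∑ j, cellWave L n (Y j) * cellAvg (m + 1) L j ψ Y) X) *
            ψ X)) =
      ∑ p : Fin (m + 1), ∑ q ∈ (Finset.univ : Finset (Fin (m + 1))).filter (fun q => p < q),
        ((∫ X in cellN (m + 1) L, (((periodizedPotential v L (X p - X q)).toReal : ℝ) : ℂ) *
            (conj (∑ i, cellWave L n (X i) * cellAvg (m + 1) L i ψ X) *
              ∑ i, cellWave L n (X i) * cellAvg (m + 1) L i ψ X)) +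
          (∫ X in cellN (m + 1) L, (((periodizedPotential v L (X p - X q)).toReal : ℝ) : ℂ) *
            (conj (∑ i, fourierAvg m L n i ψ X) * ∑ i, fourierAvg m L n i ψ X)) -
          (∫ X in cellN (m + 1) L, (((periodizedPotential v L (X p - X q)).toReal : ℝ) : ℂ) *
            (conj (∑ i, cellWave L n (X i) *
              cellAvg (m + 1) L i (fun Y => ∑ j, fourierAvg m L n j ψ Y) X) * ψ X)) -
          ∫ X in cellN (m + 1) L, (((periodizedPotential v L (X p - X q)).toReal : ℝ) : ℂ) *
            (conj (∑ i, fourierAvg m L n i (fun Y => ∑ j, cellWave L n (Y j) * cellAvg (m + 1) L j ψ Y) X) *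
              ψ X)) := by
  -- adapted from `bracket_split` (finite continuous profile)
  have hb : ∀ i, Continuous fun X => cellWave L n (X i) * cellAvg (m + 1) L i ψ X := fun i => continuous_up n i hψ
  have hF : ∀ i, Continuous (fourierAvg m L n i ψ) := fun i => continuous_fourierAvg n i hψ
  have hB : Continuous fun X => ∑ i, cellWave L n (X i) * cellAvg (m + 1) L i ψ X :=
    continuous_finsetSum _ fun i _ => hb i
  have hB' : Continuous fun X => ∑ i, fourierAvg m L n i ψ X := continuous_finsetSum _ fun i _ => hF i
  have hBB' : Continuous fun X => ∑ i, cellWave L n (X i) *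
      cellAvg (m + 1) L i (fun Y => ∑ j, fourierAvg m L n j ψ Y) X :=
    continuous_finsetSum _ fun i _ => continuous_up n i hB'
  have hB'B : Continuous fun X => ∑ i, fourierAvg m L n i (fun Y => ∑ j, cellWave L n (Y j) * cellAvg (m + 1) L j ψ Y) X :=
    continuous_finsetSum _ fun i _ => continuous_fourierAvg n i hB
  have split : ∀ {f g : Config (m + 1) → ℂ}, Continuous f → Continuous g →
      ∫ X in cellN (m + 1) L, (((periodicInteraction v L X).toReal : ℝ) : ℂ) * (conj (f X) * g X) =
        ∑ p : Fin (m + 1), ∑ q ∈ (Finset.univ : Finset (Fin (m + 1))).filter (fun q => p < q),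
          ∫ X in cellN (m + 1) L, (((periodizedPotential v L (X p - X q)).toReal : ℝ) : ℂ) * (conj (f X) * g X) := by
    intro f g hf hg
    simp_rw [toReal_periodicInteraction_bdd hC]
    rw [form_sum_weight_bdd _ (fun p _ => Finset.measurable_sum _ fun q _ => measurable_pairWeight hv L p q)
      (C := ∑ _q : Fin (m + 1), (C : ℝ))
      (fun p _ X => (norm_sum_le _ _).trans ((Finset.sum_le_sum fun q _ => norm_pairWeight_le hC p q X).trans
        (Finset.sum_le_univ_sum_of_nonneg fun _ => NNReal.coe_nonneg C))) hf hg]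
    exact Finset.sum_congr rfl fun p _ =>
      form_sum_weight_bdd _ (fun q _ => measurable_pairWeight hv L p q) (fun q _ => norm_pairWeight_le hC p q) hf hg
  rw [split hB hB, split hB' hB', split hBB' hψ, split hB'B hψ]
  simp only [Finset.sum_add_distrib, Finset.sum_sub_distrib]

/-- **The pair energies are bounded by the energy** (bounded periodisation): `Σ_{p<q} ∫ v^per(x_p − x_q)|Ψ|² ≤ E(Ψ)`.
[folklore] -/
theorem sum_pairEnergy_le_bdd (hv : IsRepulsiveFiniteRange v) (hC : ∀ x, periodizedPotential v L x ≤ C)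
    (Ψ : PeriodicTrialState (m + 1) L) (hE : periodicEnergy v Ψ ≠ ⊤) :
    ∑ p : Fin (m + 1), ∑ q ∈ (Finset.univ : Finset (Fin (m + 1))).filter (fun q => p < q),
        ∫ X in cellN (m + 1) L, (periodizedPotential v L (X p - X q)).toReal * ‖Ψ.ψ X‖ ^ 2 ≤
      (periodicEnergy v Ψ).toReal := by
  -- adapted from `sum_pairEnergy_le` (finite continuous profile)
  have hψ : Continuous Ψ.ψ := Ψ.contDiff.continuous
  have h0 : ∀ p q : Fin (m + 1),
      0 ≤ ∫ X in cellN (m + 1) L, (periodizedPotential v L (X p - X q)).toReal * ‖Ψ.ψ X‖ ^ 2 := fun p q =>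
    integral_nonneg fun X => mul_nonneg ENNReal.toReal_nonneg (sq_nonneg _)
  rw [← ENNReal.ofReal_le_iff_le_toReal hE, ENNReal.ofReal_sum_of_nonneg fun p _ => Finset.sum_nonneg fun q _ => h0 p q]
  calc ∑ p : Fin (m + 1), ENNReal.ofReal (∑ q ∈ (Finset.univ : Finset (Fin (m + 1))).filter (fun q => p < q),
        ∫ X in cellN (m + 1) L, (periodizedPotential v L (X p - X q)).toReal * ‖Ψ.ψ X‖ ^ 2)
      = ∑ p : Fin (m + 1), ∑ q ∈ (Finset.univ : Finset (Fin (m + 1))).filter (fun q => p < q),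
          ∫⁻ X in cellN (m + 1) L, periodizedPotential v L (X p - X q) * ((‖Ψ.ψ X‖₊ : ℝ≥0∞)) ^ 2 := by
        refine Finset.sum_congr rfl fun p _ => ?_
        rw [ENNReal.ofReal_sum_of_nonneg fun q _ => h0 p q]
        exact Finset.sum_congr rfl fun q _ => ofReal_integral_pairWeight_norm_sq_bdd hv hC p q hψ
    _ = ∫⁻ X in cellN (m + 1) L, periodicInteraction v L X * ((‖Ψ.ψ X‖₊ : ℝ≥0∞)) ^ 2 :=
        (Bare.lintegral_interaction_mul_eq_sum hv.1 L (Bare.measurable_nnnorm_sq hψ.measurable)).symm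
    _ ≤ periodicEnergy v Ψ := by
        unfold periodicEnergy
        exact lintegral_mono fun X => le_add_self

end AssemblyBdd

/-- **`PlainInteractionBound` for a BOUNDED admissible profile**: for `v` measurable of finite range with `v ≤ B` on
`[0, ∞)` there is `C` (`= 8(‖v‖₁ + √‖v‖₁) + 1`) such that for every periodic trial state `Ψ` of finite energy and every
mode `n`, `|𝒟^V(Ψ)| ≤ C(ρ + √(ρE(Ψ)/N))`, `ρ = N/L³` — the proof of `stub_plainInteraction` verbatim, the pair weight
being bounded measurable instead of continuous. [folklore] -/
theorem plainInteractionBound_bdd {v : ℝ → ℝ≥0∞} (hv : IsRepulsiveFiniteRange v) {B : ℝ}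
    (hB : ∀ r, 0 ≤ r → v r ≤ ENNReal.ofReal B) :
    ∃ C : ℝ, 0 < C ∧ ∀ (m : ℕ) (L : ℝ), 0 < L → ∀ (n : Fin 3 → ℤ) (Ψ : PeriodicTrialState (m + 1) L),
      periodicEnergy v Ψ ≠ ⊤ →
        |plainInteractionDefect v m L n Ψ.ψ| ≤
          C * (((m + 1 : ℕ) : ℝ) / L ^ 3 +
            Real.sqrt ((((m + 1 : ℕ) : ℝ) / L ^ 3) * (periodicEnergy v Ψ).toReal / ((m + 1 : ℕ) : ℝ))) := by
  -- adapted from `stub_plainInteraction` (finite continuous profile)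
  have hint : (∫⁻ x : Space, v ‖x‖) ≠ ⊤ := lintegral_ne_top_of_bdd hv hB
  obtain ⟨nv, hnv⟩ : ∃ nv : ℝ, nv = (∫⁻ x : Space, v ‖x‖).toReal := ⟨_, rfl⟩
  have hnv0 : 0 ≤ nv := by rw [hnv]; exact ENNReal.toReal_nonneg
  refine ⟨8 * (nv + Real.sqrt nv) + 1, by positivity, ?_⟩
  intro m L hL n Ψ hE
  obtain ⟨Cp, hCp⟩ := exists_periodized_bound_of_bdd hv hB hL
  have hψ : Continuous Ψ.ψ := Ψ.contDiff.continuous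
  have hψ1 : ∫ X in cellN (m + 1) L, ‖Ψ.ψ X‖ ^ 2 ≤ 1 := (integral_norm_sq_trialState Ψ).le
  have hN : (0 : ℝ) < ((m + 1 : ℕ) : ℝ) := by positivity
  have hL3 : (0 : ℝ) < L ^ 3 := by positivity
  obtain ⟨σ, hσ⟩ : ∃ σ : ℝ, σ = ((ENNReal.ofReal (L ^ 3))⁻¹ * ∫⁻ x : Space, v ‖x‖).toReal := ⟨_, rfl⟩
  have hσ0 : 0 ≤ σ := by rw [hσ]; exact ENNReal.toReal_nonneg
  have hσeq : σ = nv / L ^ 3 := by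
    rw [hσ, ENNReal.toReal_mul, ENNReal.toReal_inv, ENNReal.toReal_ofReal hL3.le, hnv, div_eq_inv_mul]
  set E : ℝ := (periodicEnergy v Ψ).toReal with hEdef
  have hE0 : 0 ≤ E := ENNReal.toReal_nonneg
  have hsum := sum_pairEnergy_le_bdd hv hCp Ψ hE
  rw [defect_eq v L n Ψ.ψ, bracket_split_bdd hv hCp n hψ, Complex.re_sum]
  simp_rw [Complex.re_sum]
  have key := abs_sum_pairs_le (N := m + 1) hσ0 (E := E)
    (fun p q => ((∫ X in cellN (m + 1) L, (((periodizedPotential v L (X p - X q)).toReal : ℝ) : ℂ) *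
            (conj (∑ i, cellWave L n (X i) * cellAvg (m + 1) L i Ψ.ψ X) *
              ∑ i, cellWave L n (X i) * cellAvg (m + 1) L i Ψ.ψ X)) +
          (∫ X in cellN (m + 1) L, (((periodizedPotential v L (X p - X q)).toReal : ℝ) : ℂ) *
            (conj (∑ i, fourierAvg m L n i Ψ.ψ X) * ∑ i, fourierAvg m L n i Ψ.ψ X)) -
          (∫ X in cellN (m + 1) L, (((periodizedPotential v L (X p - X q)).toReal : ℝ) : ℂ) *
            (conj (∑ i, cellWave L n (X i) *
              cellAvg (m + 1) L i (fun Y => ∑ j, fourierAvg m L n j Ψ.ψ Y) X) * Ψ.ψ X)) -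
          ∫ X in cellN (m + 1) L, (((periodizedPotential v L (X p - X q)).toReal : ℝ) : ℂ) *
            (conj (∑ i, fourierAvg m L n i (fun Y => ∑ j, cellWave L n (Y j) * cellAvg (m + 1) L j Ψ.ψ Y) X) *
              Ψ.ψ X)).re)
    (fun p q => ∫ X in cellN (m + 1) L, (periodizedPotential v L (X p - X q)).toReal * ‖Ψ.ψ X‖ ^ 2)
    (fun p q => integral_nonneg fun X => mul_nonneg ENNReal.toReal_nonneg (sq_nonneg _))
    (fun p q hpq => by
      have h := abs_re_pairBracket_le_bdd hL hv hCp n (ne_of_lt hpq) hψ hψ1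
      rw [← hσ] at h
      exact h)
    hsum
  have hρE : ((m + 1 : ℕ) : ℝ) / L ^ 3 * E / ((m + 1 : ℕ) : ℝ) = E / L ^ 3 := by
    field_simp
  have hsq : Real.sqrt σ * Real.sqrt E = Real.sqrt nv * Real.sqrt (E / L ^ 3) := by
    rw [← Real.sqrt_mul hσ0, ← Real.sqrt_mul hnv0, hσeq]
    congr 1
    field_simp
  rw [hρE, abs_mul, abs_of_pos (inv_pos.2 hN)]
  calc (((m + 1 : ℕ) : ℝ))⁻¹ * _ ≤ (((m + 1 : ℕ) : ℝ))⁻¹ *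
        (8 * σ * ((m + 1 : ℕ) : ℝ) ^ 2 + 8 * ((m + 1 : ℕ) : ℝ) * (Real.sqrt σ * Real.sqrt E)) :=
        mul_le_mul_of_nonneg_left key (inv_nonneg.2 hN.le)
    _ = 8 * nv * (((m + 1 : ℕ) : ℝ) / L ^ 3) + 8 * Real.sqrt nv * Real.sqrt (E / L ^ 3) := by
        rw [hsq, hσeq]
        field_simp
    _ ≤ (8 * (nv + Real.sqrt nv) + 1) * (((m + 1 : ℕ) : ℝ) / L ^ 3 + Real.sqrt (E / L ^ 3)) := by
        have hρ0 : 0 ≤ ((m + 1 : ℕ) : ℝ) / L ^ 3 := by positivity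
        have hs0 : 0 ≤ Real.sqrt (E / L ^ 3) := Real.sqrt_nonneg _
        have hr0 : 0 ≤ Real.sqrt nv := Real.sqrt_nonneg _
        nlinarith [mul_nonneg hnv0 hs0, mul_nonneg hr0 hρ0, mul_nonneg hnv0 hρ0, mul_nonneg hr0 hs0]

end PlainInteraction

/-- **Part 3 of `stub_bandEmptinessBdd` (registered helper statement)**: the interaction double commutator of the plain
pair is state-independent for every admissible BOUNDED profile (`v` measurable of finite range, `v ≤ B` on `[0, ∞)`): a
constant `C` with `|𝒟^V(Ψ)| ≤ C(ρ + √(ρE(Ψ)/N))`, `ρ = N/L³`, for every periodic trial state `Ψ` of finite energy and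
every mode `n` — the conclusion of `PlainInteractionBound` without continuity of the profile. [folklore]
(KennedyLiebShastry1988 §2; arXiv:1211.2778 §2; LSSY2005 App. A) -/
theorem plainInteractionBdd_bound : ∀ (v : ℝ → ENNReal) (B : ℝ), Literature.MathematicalPhysics.QuantumManyBody.BoseGas.IsRepulsiveFiniteRange v → (∀ r : ℝ, 0 ≤ r → v r ≤ ENNReal.ofReal B) → ∃ C : ℝ, 0 < C ∧ ∀ (m : ℕ) (L : ℝ), 0 < L → ∀ (n : Fin 3 → ℤ) (Ψ : Literature.MathematicalPhysics.QuantumManyBody.BoseGas.PeriodicTrialState (m + 1) L), Literature.MathematicalPhysics.QuantumManyBody.BoseGas.periodicEnergy v Ψ ≠ ⊤ → |Summit.AtomisticToContinuum.BoseEinsteinCondensation.Cruxes.GDTransfer.Seeded.plainInteractionDefect v m L n Ψ.ψ| ≤ C * (((m + 1 : ℕ) : ℝ) / L ^ 3 + Real.sqrt ((((m + 1 : ℕ) : ℝ) / L ^ 3) * (Literature.MathematicalPhysics.QuantumManyBody.BoseGas.periodicEnergy v Ψ).toReal / ((m + 1 : ℕ) : ℝ))) :=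
  fun _ _ hv hB => PlainInteraction.plainInteractionBound_bdd hv hB

end Summit.AtomisticToContinuum.BoseEinsteinCondensation.Cruxes.GDTransfer.Seeded

end
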